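import Summits.RiemannHypothesis.RiemannHypothesis.Theorems.Splittings.RobinFiniteC1All
import HarnessLib


/-!
# RobinFiniteHeightLawBudget — gen 9 height law, part 1/2 (L1–L4): the `θ`-window at an arbitrary verification height, the
# unbounded top window against the lifted constant `2.5745`, budget ⟹ Büthe range, and `robinCA_below_of_height`

Typer split (rh-split-typer-1 g5) of the seat file `HOME/rh-split-robin-finite/g9/RobinFiniteHeightLaw.lean` sha16 1ec531314df393c6
(589 l > the 400-line cap) at the L4/L5 boundary; declarations byte-identical; part 2/2 = `RobinFiniteHeightLaw.lean` (L5–L7: closed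
form, monotonicity, all-integers form, instances; carries the full provenance docstring).  Hypotheses throughout: the three RH-free
`θ`-facts in print (Büthe 2016 Thm 2, Büthe 2018 Thm 2, BKLNW 2021) and `RiemannHypothesisUpTo T`, `T ≥ 3 000 175 332 800`.
Cell rh-split, seat rh-split-robin-finite g9 (brief sha16 f79c5f09d8bcb036), card `cards/SPLIT-robin-finite.md` §16; kernel object
`HOME/rh-split-robin-finite/g9/SketchG9-Law.lean`.  Zero `def`, zero `instance`, zero `notation`, no attribute changes, no `native_decide`.

HONEST LABEL: SPLITTING SEARCH over kernel-typed RH-EQUIVALENCES; a splitting A ∧ B ⟹ RH is CONDITIONAL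
bookkeeping unless A and B are both proved; nothing here bears on the truth of RH.
-/


set_option linter.dupNamespace false

noncomputable section

open Real Filter Finset
open scoped Chebyshev

namespace Summit.RiemannHypothesis.RiemannHypothesis.Theorems.Splittings.RobinFiniteC1

open Literature.NumberTheory.LFunctions Literature.NumberTheory.DiophantineGeometry
open RobinAnalyticSharp
open Summit.RiemannHypothesis.RiemannHypothesis.Theorems.Splittings.RobinFiniteE3

section HeightLaw

/-! ### L1 · the `θ`-window at an arbitrary verification height -/

/-- For `e ≤ x ≤ x₀`: `x / log x ≤ x₀ / log x₀` (`log x / x` is antitone on `[e, ∞)`, `Real.log_div_self_antitoneOn`).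
Folklore; the tree's copies are private (`ButhePartialRH.div_log_le_div_log`, `EtaPrmSixtyBlocks.div_log_mono`, …) or sit
behind an unrelated heavy import (`SoundContour.div_log_mono`) — restated PRIVATELY here (dedup guard). -/
private theorem div_log_mono {x x₀ : ℝ} (hx : Real.exp 1 ≤ x) (hxx₀ : x ≤ x₀) :
    x / Real.log x ≤ x₀ / Real.log x₀ := by
  have hx0 : 0 < x := (Real.exp_pos 1).trans_le hx
  have hx₀0 : 0 < x₀ := hx0.trans_le hxx₀
  have h1x : 1 < x := (lt_trans (by norm_num) Real.exp_one_gt_d9).trans_le hx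
  have hlogx : 0 < Real.log x := Real.log_pos h1x
  have hlogx₀ : 0 < Real.log x₀ := Real.log_pos (h1x.trans_le hxx₀)
  have hanti := Real.log_div_self_antitoneOn (Set.mem_Ici.2 hx) (Set.mem_Ici.2 (hx.trans hxx₀)) hxx₀
  rw [div_le_div_iff₀ hlogx hlogx₀]
  have := (div_le_div_iff₀ hx₀0 hx0).1 hanti
  linarith

/-- Büthe's range condition is monotone: `4.92·√(y/log y) ≤ 4.92·√(B/log B) ≤ T` for `e ≤ y ≤ B`. -/
theorem buthe_range_mono {T B y : ℝ} (hy : Real.exp 1 ≤ y) (hyB : y ≤ B)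
    (hB : 4.92 * Real.sqrt (B / Real.log B) ≤ T) : 4.92 * Real.sqrt (y / Real.log y) ≤ T :=
  le_trans (mul_le_mul_of_nonneg_left (Real.sqrt_le_sqrt (div_log_mono hy hyB)) (by norm_num)) hB

/-- **The `θ`-window at ANY verification height `T ≥ 3 000 175 332 800`.**  Büthe 2016 (Thm 2) with RH verified to `T`
gives `|θ y − y| ≤ √y log² y/(8π)` on `[599, B]` as soon as `4.92·√(B/log B) ≤ T`: for `y ≤ 2.169·10²⁵` this is the tree's
Platt–Trudgian window `RobinFiniteE1c.schoenfeldThetaOn_of_buthe2016` (via `RiemannHypothesisUpTo.mono_of_le`; it also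
settles Büthe's excluded endpoint `y = 599`), for `y > 2.169·10²⁵` Büthe at height `T` directly. -/
theorem thetaWindow_of_height (h16 : Buthe2016_thm2) {T B : ℝ} (hT : 3000175332800 ≤ T)
    (hRH : RiemannHypothesisUpTo T) (hB : 4.92 * Real.sqrt (B / Real.log B) ≤ T) :
    ∀ y : ℝ, 599 ≤ y → y ≤ B → |θ y - y| ≤ √y * Real.log y ^ 2 / (8 * π) := by
  intro y hy hyB
  by_cases hy25 : y ≤ 2.169e25
  · exact Summit.RiemannHypothesis.RiemannHypothesis.Theorems.Splittings.RobinFiniteE1c.schoenfeldThetaOn_of_buthe2016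
      h16 (RiemannHypothesisUpTo.mono_of_le hT hRH) le_rfl y hy hy25
  · rw [not_le] at hy25
    have hT0 : 0 < T := lt_of_lt_of_le (by norm_num) hT
    have hey : Real.exp 1 ≤ y := le_trans (le_trans Real.exp_one_lt_d9.le (by norm_num)) hy25.le
    have h1 := (h16 T hT0 hRH y (buthe_range_mono hey hyB hB)).2.1 (by linarith)
    calc |θ y - y| ≤ Real.sqrt y / (8 * π) * Real.log y ^ 2 := h1
      _ = _ := by ring

/-! ### L2 · the top window `[2·10²², X]`: a box bound with no upper end, against the lifted constant `2.5745` -/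

/-- **Box bound for `Eb b` on an UNBOUNDED window `[X₀, ∞)`** (cf. `RobinFiniteE3Error.Eb_mul_le_box`): for `b ≤ 0.68`
the two `log P` terms of `Eb_mul_eq` are jointly non-positive (`(8.168 + 4b)/L ≤ 2.042 − b` once `L ≥ 8`), so with
`8 ≤ L₁ ≤ log X₀ ≤ U₁`, `0 < s₁ ≤ √X₀`, `0 < y₁ ≤ X₀^{1/6}` and ANY `P ≥ X₀`:
`Eb b P·√P log P ≤ (b + 2.042) + 1.84/s₁ + 2/y₁ + U₁⁴/(631.65 s₁)`. -/
theorem Eb_mul_le_box_top {b P X₀ L₁ U₁ s₁ y₁ : ℝ} (hb : b ≤ 0.68) (hX₀ : 1 < X₀)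
    (hPl : X₀ ≤ P) (hL₁ : L₁ ≤ Real.log X₀) (hU₁ : Real.log X₀ ≤ U₁) (hL₁8 : 8 ≤ L₁)
    (hs₁ : s₁ ≤ √X₀) (hs₁0 : 0 < s₁) (hy₁ : y₁ ≤ X₀ ^ ((1 : ℝ) / 6)) (hy₁0 : 0 < y₁) :
    (nicolasERH P + (b - nicolasBeta) * (1 / (√P * Real.log P) + 1 / (√P * Real.log P ^ 2) + 4 / (√P * Real.log P ^ 3))) * (√P * Real.log P) ≤
      (b + 2.042) + 1.84 / s₁ + 2 / y₁ + U₁ ^ 4 / (631.65 * s₁) := by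
  have hX₀0 : 0 < X₀ := by linarith
  have hP0 : 0 < P := by linarith
  have hP1 : 1 < P := by linarith
  rw [Eb_mul_eq hP1]
  set L := Real.log P with hL
  set s := √P with hs
  set y := P ^ ((1 : ℝ) / 6) with hy
  have hs0 : 0 < s := Real.sqrt_pos.2 hP0
  have hLX₀ : Real.log X₀ ≤ L := Real.log_le_log hX₀0 hPl
  have hLl : L₁ ≤ L := hL₁.trans hLX₀
  have hL8 : 8 ≤ L := hL₁8.trans hLl
  have hL0 : 0 < L := by linarith
  have hsl : s₁ ≤ s := hs₁.trans (Real.sqrt_le_sqrt hPl)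
  have hyl : y₁ ≤ y := hy₁.trans (Real.rpow_le_rpow hX₀0.le hPl (by norm_num))
  -- the two `L` terms are jointly `≤ 0`
  have hnum : 8.168 + 4 * b ≤ (2.042 - b) * L := by
    nlinarith [mul_nonneg (sub_nonneg.2 (show b ≤ 2.042 by linarith)) (sub_nonneg.2 hL8)]
  have b23 : -((2.042 - b) / L) + (8.168 + 4 * b) / L ^ 2 ≤ 0 := by
    have h1 : (8.168 + 4 * b) / L ^ 2 ≤ (2.042 - b) / L := by
      rw [div_le_div_iff₀ (by positivity) hL0]
      calc (8.168 + 4 * b) * L ≤ ((2.042 - b) * L) * L := mul_le_mul_of_nonneg_right hnum hL0.le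
        _ = (2.042 - b) * L ^ 2 := by ring
    linarith
  have b4 : Real.log (2 * π) / s ≤ 1.84 / s₁ := by
    have h0 : 0 ≤ Real.log (2 * π) := Real.log_nonneg (by linarith [Real.pi_gt_three])
    calc Real.log (2 * π) / s ≤ Real.log (2 * π) / s₁ := div_le_div_of_nonneg_left h0 hs₁0 hsl
      _ ≤ 1.84 / s₁ := div_le_div_of_nonneg_right log_two_pi_le hs₁0.le
  have b5 : 2 / y ≤ 2 / y₁ := div_le_div_of_nonneg_left (by norm_num) hy₁0 hyl
  have b6 : L ^ 4 / s / (64 * π ^ 2) ≤ U₁ ^ 4 / (631.65 * s₁) := by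
    have hanti := log_pow_div_rpow_le (a := 1 / 2) (by norm_num) (k := 4) (by norm_num) hX₀0
      (le_trans (by norm_num) (hL₁8.trans hL₁)) hPl
    have e1 : L ^ 4 / s = Real.log P ^ 4 / P ^ ((1 : ℝ) / 2) := by rw [hs, Real.sqrt_eq_rpow]
    have e2 : Real.log X₀ ^ 4 / X₀ ^ ((1 : ℝ) / 2) ≤ U₁ ^ 4 / s₁ := by
      have h0 : 0 ≤ Real.log X₀ := by linarith
      calc Real.log X₀ ^ 4 / X₀ ^ ((1 : ℝ) / 2) ≤ U₁ ^ 4 / X₀ ^ ((1 : ℝ) / 2) :=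
            div_le_div_of_nonneg_right (pow_le_pow_left₀ h0 hU₁ 4) (by positivity)
        _ ≤ U₁ ^ 4 / s₁ := by
            apply div_le_div_of_nonneg_left (by positivity) hs₁0
            rwa [← Real.sqrt_eq_rpow]
    have hpi : (9.8696 : ℝ) ≤ π ^ 2 := pi_sq_ge
    calc L ^ 4 / s / (64 * π ^ 2) ≤ U₁ ^ 4 / s₁ / (64 * π ^ 2) := by
          rw [e1]; exact div_le_div_of_nonneg_right (hanti.trans e2) (by positivity)
      _ ≤ U₁ ^ 4 / s₁ / 631.65 := by
          apply div_le_div_of_nonneg_left (by positivity) (by norm_num); linarith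
      _ = U₁ ^ 4 / (631.65 * s₁) := by rw [div_div, mul_comm]
  linarith

/-- `51.35 ≤ log(2·10²²) ≤ 51.351`. -/
theorem log_2e22_bounds : (51.35 : ℝ) ≤ Real.log (2 * (10 : ℝ) ^ 22) ∧ Real.log (2 * (10 : ℝ) ^ 22) ≤ 51.351 := by
  have e0 := log_mul_ten_pow (a := 2) (by norm_num) 22
  have h2l := Real.log_two_gt_d9
  have h2u := Real.log_two_lt_d9
  have h10 := RobinAnalytic.log_ten_lt
  have h10' := RobinAnalytic.log_ten_gt
  rw [e0]; push_cast
  constructor <;> linarith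

/-- **The top window `[2·10²², ∞)` against the lifted constant `c(51.35) = 2.5745`, at ANY admissible budget**: if
`(1 + 2/log(2·10²²))·t ≤ 0.4857` (below `t = tailH(T)·√X`; no sign condition on `t` is needed), then
`Eb (0.0463 + (1 + 2/log(2·10²²))·t) P·√P log P < 2.5745` for every `P ≥ 2·10²²` — enclosures
`51.35 ≤ log(2·10²²) ≤ 51.351`, `141421356237 ≤ √(2·10²²)`, `5210 ≤ (2·10²²)^{1/6}`; box
`0.532 + 2.042 + 1.31·10⁻¹¹ + 3.8388·10⁻⁴ + 7.79·10⁻⁸ = 2.574384 < 2.5745` (margin `1.2·10⁻⁴`). -/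
theorem Eb_top_lt {P t : ℝ} (h0 : 2 * (10 : ℝ) ^ 22 ≤ P)
    (hκ : (1 + 2 / Real.log (2 * (10 : ℝ) ^ 22)) * t ≤ 0.4857) :
    (nicolasERH P + ((0.0463 + (1 + 2 / Real.log (2 * (10 : ℝ) ^ 22)) * t) - nicolasBeta) * (1 / (√P * Real.log P) + 1 / (√P * Real.log P ^ 2) + 4 / (√P * Real.log P ^ 3))) * (√P * Real.log P) < 2.5745 := by
  obtain ⟨hL, hU⟩ := log_2e22_bounds
  obtain ⟨hs, -⟩ := sqrt_between (s := 141421356237) (u := 141421356238) (X := 2 * (10 : ℝ) ^ 22)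
    (by norm_num) (by norm_num) (by norm_num)
  have hy := le_rpow_sixth (X := 2 * (10 : ℝ) ^ 22) (y := 5210) (by norm_num) (by norm_num)
  have hb68 : 0.0463 + (1 + 2 / Real.log (2 * (10 : ℝ) ^ 22)) * t ≤ 0.68 := by
    -- `linarith` must not see the numeral `2·10²²` inside `log` (cancel_denoms normalises it in some hypotheses only)
    set L0 : ℝ := Real.log (2 * (10 : ℝ) ^ 22) with hL0_def
    linarith
  have hbox := Eb_mul_le_box_top (P := P) (b := 0.0463 + (1 + 2 / Real.log (2 * (10 : ℝ) ^ 22)) * t) hb68 (by norm_num) h0 hL hU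
    (by norm_num) hs
    (by norm_num) hy (by norm_num)
  have hnum : (1.84 : ℝ) / 141421356237 + 2 / 5210 + (51.351 : ℝ) ^ 4 / (631.65 * 141421356237) <
      2.5745 - 2.042 - 0.0463 - 0.4857 := by norm_num
  clear hs hy
  set L0 : ℝ := Real.log (2 * (10 : ℝ) ^ 22) with hL0_def
  linarith

/-! ### L3 · the budget implies Büthe's range condition -/

/-- **The budget hypothesis implies Büthe's range condition for the window `[599, X]`.**  For `T ≥ 3 000 175 332 800`:
`log(T/2π) ≥ 1`, so `tailH(T) ≥ 2/(πT)`; the budget `(1 + 2/log(2·10²²))·tailH(T)·√X ≤ 0.4857` forces `√X ≤ 0.763·T`,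
`X ≤ 0.5822·T²`, and with `log X ≥ 51.35` (`X ≥ 2·10²²`): `X/log X ≤ (T/4.92)²`. -/
theorem buthe_range_of_budget {T X : ℝ} (hT : 3000175332800 ≤ T) (hX : 2 * (10 : ℝ) ^ 22 ≤ X)
    (hκ : (1 + 2 / Real.log (2 * (10 : ℝ) ^ 22)) *
      (((Real.log (T / (2 * π)) + 1) / (π * T) + (184 + 30 * Real.log T) / T ^ 2) * √X) ≤ 0.4857) :
    4.92 * Real.sqrt (X / Real.log X) ≤ T := by
  have hπl := Real.pi_gt_d6
  have hπu := Real.pi_lt_d6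
  have hT0 : 0 < T := lt_of_lt_of_le (by norm_num) hT
  have hX0 : 0 < X := lt_of_lt_of_le (by norm_num) hX
  have hsX : 0 ≤ √X := Real.sqrt_nonneg X
  have hπT : 0 < π * T := mul_pos Real.pi_pos hT0
  -- `log(T/(2π)) ≥ 1`
  have hlog2π : 1 ≤ Real.log (T / (2 * π)) := by
    rw [Real.le_log_iff_exp_le (div_pos hT0 (by positivity)), le_div_iff₀ (by positivity)]
    have he := Real.exp_one_lt_d9
    have h1 : Real.exp 1 * (2 * π) ≤ 2.7182818286 * 6.283186 :=
      mul_le_mul he.le (by linarith) (by positivity) (by norm_num)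
    linarith
  have hlogT : 0 ≤ Real.log T := Real.log_nonneg (by linarith)
  -- `tailH(T) ≥ 2/(πT)`
  have htail : 2 / (π * T) ≤ (Real.log (T / (2 * π)) + 1) / (π * T) + (184 + 30 * Real.log T) / T ^ 2 := by
    have h1 : 2 / (π * T) ≤ (Real.log (T / (2 * π)) + 1) / (π * T) :=
      div_le_div_of_nonneg_right (by linarith) hπT.le
    have h2 : 0 ≤ (184 + 30 * Real.log T) / T ^ 2 := div_nonneg (by linarith) (sq_nonneg T)
    linarith
  have h2πT : 0 ≤ 2 / (π * T) := (div_pos two_pos hπT).le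
  -- the budget forces `2√X/(πT) ≤ 0.4857`
  have hL0 : 0 < Real.log (2 * (10 : ℝ) ^ 22) := lt_of_lt_of_le (by norm_num) log_2e22_bounds.1
  have hfac : 1 ≤ 1 + 2 / Real.log (2 * (10 : ℝ) ^ 22) :=
    le_add_of_nonneg_right (div_nonneg (by norm_num) hL0.le)
  have ht0 : 0 ≤ ((Real.log (T / (2 * π)) + 1) / (π * T) + (184 + 30 * Real.log T) / T ^ 2) * √X :=
    mul_nonneg (h2πT.trans htail) hsX
  have ht1 : ((Real.log (T / (2 * π)) + 1) / (π * T) + (184 + 30 * Real.log T) / T ^ 2) * √X ≤ 0.4857 :=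
    le_trans (le_mul_of_one_le_left ht0 hfac) hκ
  have h2 : 2 / (π * T) * √X ≤ 0.4857 := le_trans (mul_le_mul_of_nonneg_right htail hsX) ht1
  clear hκ hfac hL0
  -- hence `√X ≤ 0.763·T` and `X ≤ 0.5822·T²`
  have hsqrt : √X ≤ 0.763 * T := by
    rw [div_mul_eq_mul_div, div_le_iff₀ hπT] at h2
    nlinarith [mul_nonneg (sub_nonneg.2 hπu.le) hT0.le]
  have hXT : X ≤ 0.5822 * T ^ 2 := by
    have h1 : √X * √X ≤ (0.763 * T) * (0.763 * T) := mul_le_mul hsqrt hsqrt hsX (by positivity)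
    rw [Real.mul_self_sqrt hX0.le] at h1
    nlinarith
  -- `log X ≥ 51.35`
  have hlogX : (51.35 : ℝ) ≤ Real.log X := log_2e22_bounds.1.trans (Real.log_le_log (by norm_num) hX)
  have hq : X / Real.log X ≤ (T / 4.92) ^ 2 := by
    have e : (T / 4.92) ^ 2 = T ^ 2 / 24.2064 := by ring
    rw [e, div_le_div_iff₀ (by linarith) (by norm_num)]
    nlinarith [mul_nonneg (sq_nonneg T) (sub_nonneg.2 hlogX)]
  calc 4.92 * Real.sqrt (X / Real.log X) ≤ 4.92 * Real.sqrt ((T / 4.92) ^ 2) :=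
        mul_le_mul_of_nonneg_left (Real.sqrt_le_sqrt hq) (by norm_num)
    _ = T := by rw [Real.sqrt_sq (by positivity)]; ring

/-! ### L4 · the CA Mertens inequality and Robin at CA numbers, at height `T` -/

/-- **The CA Mertens inequality for `4¹¹ ≤ P ≤ X`, `Q ≤ P`, at ANY verification height `T ≥ 3 000 175 332 800`** with the
budget condition `(1 + 2/log(2·10²²))·tailH(T)·√X ≤ 0.4857`: below `2.5·10²²` gen 8's dispatch `mertensProdLt_PT2`
(RH to height `T` ⟹ RH to the Platt–Trudgian height); on `(2.5·10²², X]` the top window `[2·10²², X]`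
(`partialNicolasBetween1_tailFree` at height `T`, `Eb_top_lt`, `G_large2W` with `L₁ = 51.35`, `c = 2.5745`). -/
theorem mertensProdLt_of_height (h16 : Buthe2016_thm2) (hB : Buthe2018_thm2_theta)
    (hK : BroadbentEtAl2021_theta_rel_1e19) {T : ℝ} (hT : 3000175332800 ≤ T) (hRH : RiemannHypothesisUpTo T)
    {X : ℝ} (hκ : (1 + 2 / Real.log (2 * (10 : ℝ) ^ 22)) *
      (((Real.log (T / (2 * π)) + 1) / (π * T) + (184 + 30 * Real.log T) / T ^ 2) * √X) ≤ 0.4857)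
    {P Q : ℕ} (hP : 4 ^ 11 ≤ P) (hPX : (P : ℝ) ≤ X) (hQP : Q ≤ P) :
    (∏ p ∈ Nat.primesLE P, (1 - (p : ℝ)⁻¹))⁻¹ *
        ∏ p ∈ (Nat.primesLE P).filter (fun p => Q < p), (1 - ((p : ℝ) ^ 2)⁻¹) <
      rexp eulerMascheroniConstant * Real.log (θ P + θ Q) := by
  rcases le_or_gt (P : ℝ) (25 * (10 : ℝ) ^ 21) with hlo | hhi
  · exact mertensProdLt_PT2 h16 hB hK (RiemannHypothesisUpTo.mono_of_le hT hRH) hP hlo hQP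
  · -- the top window `(2.5·10²², X]` at height `T`
    have h22 : 2 * (10 : ℝ) ^ 22 ≤ P := le_trans (by norm_num) hhi.le
    have hX : 2 * (10 : ℝ) ^ 22 ≤ X := h22.trans hPX
    have hW := thetaWindow_of_height h16 hT hRH (buthe_range_of_budget hT hX hκ)
    have hT7 : (7 : ℝ) ≤ T := le_trans (by norm_num) hT
    have hPr : (4 : ℝ) ^ 11 ≤ P := by exact_mod_cast hP
    have hP599 : (599 : ℝ) ≤ P := le_trans (by norm_num) hPr
    have hP1 : (1 : ℝ) < P := by linarith
    have hbig19 : (2 * 10 ^ 19 : ℝ) ≤ P := le_trans (by norm_num) h22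
    have hlow := partialNicolasBetween1_tailFree hB hK (T := T) (B := X) (X₀ := 2 * (10 : ℝ) ^ 22) (X₁ := X)
      hT7 (by norm_num) le_rfl hRH hW P hP599 h22 hPX
    have hsL : 0 < √(P : ℝ) * Real.log P := mul_pos (Real.sqrt_pos.2 (by linarith)) (Real.log_pos hP1)
    have hlt := Eb_top_lt h22 hκ
    have hL₁P : (51.35 : ℝ) ≤ Real.log P := log_2e22_bounds.1.trans (Real.log_le_log (by norm_num) h22)
    have hG := G_large2W hW hbig19 hPX hQP hL₁P (by norm_num) (c := 2.5745) (by norm_num) (by norm_num)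
    exact mertens_prod_lt_of hW hP hPX hlow (((lt_div_iff₀ hsL).2 hlt).trans_le hG)

open scoped ArithmeticFunction.sigma in
/-- **THE HEIGHT LAW (budget form).  Robin's inequality at every colossally abundant `N > 5040` all of whose primes are
`≤ X`, from the three RH-free `θ`-facts in print and RH verified to ANY height `T ≥ 3 000 175 332 800`, for every natural
`X` with `(1 + 2/log(2·10²²))·tailH(T)·√X ≤ 0.4857`** (`robinCA_below_PT2`'s bookkeeping with `mertensProdLt_of_height`).
Nothing here bears on the truth of RH. -/
theorem robinCA_below_of_height (h16 : Buthe2016_thm2) (hB : Buthe2018_thm2_theta)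
    (hK : BroadbentEtAl2021_theta_rel_1e19) {T : ℝ} (hT : 3000175332800 ≤ T) (hRH : RiemannHypothesisUpTo T)
    {X : ℕ} (hκ : (1 + 2 / Real.log (2 * (10 : ℝ) ^ 22)) *
      (((Real.log (T / (2 * π)) + 1) / (π * T) + (184 + 30 * Real.log T) / T ^ 2) * √(X : ℝ)) ≤ 0.4857) :
    robinCA_below (X + 1) := by
  intro N hCA h5040 hprimes
  obtain ⟨ε, P, Q, -, -, hP, hPN, -, hQP, hpf, -, -, hσ, hθ, -⟩ := hCA.exists_structure
  by_cases hsmall : P < 4 ^ 11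
  · refine robinCA_below_four_pow_eleven N hCA h5040 fun p hp hpN => lt_of_le_of_lt ?_ hsmall
    have hN0 : N ≠ 0 := by omega
    have : p ∈ N.primeFactors := Nat.mem_primeFactors.2 ⟨hp, hpN, hN0⟩
    rw [hpf] at this
    exact (Nat.mem_primesLE.1 this).1
  · rw [not_lt] at hsmall
    have hPX : (P : ℝ) ≤ X := by
      have := hprimes P hP hPN
      exact_mod_cast Nat.lt_succ_iff.1 this
    have hlt := mertensProdLt_of_height h16 hB hK hT hRH hκ hsmall hPX hQP
    have hN0 : N ≠ 0 := by omega
    have hNpos : (0 : ℝ) < N := by exact_mod_cast Nat.pos_of_ne_zero hN0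
    have hθpos : 0 < θ P + θ Q := by
      have h1 : 0 < θ (P : ℝ) := Chebyshev.theta_pos (by exact_mod_cast hP.two_le)
      have h2 : 0 ≤ θ (Q : ℝ) := Chebyshev.theta_nonneg _
      linarith
    have hlog : Real.log (θ P + θ Q) ≤ Real.log (Real.log N) := Real.log_le_log hθpos hθ
    have hlt' : (σ 1 N : ℝ) / N < rexp eulerMascheroniConstant * Real.log (Real.log N) :=
      lt_of_le_of_lt hσ (hlt.trans_le (mul_le_mul_of_nonneg_left hlog (Real.exp_pos _).le))
    unfold robinInequality
    rw [div_lt_iff₀ hNpos] at hlt'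
    linarith

end HeightLaw

end Summit.RiemannHypothesis.RiemannHypothesis.Theorems.Splittings.RobinFiniteC1
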